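import Mathlib
import Literature.Barriers.MatrixMultiplication.NormalizerBarrier

/-!
# Block slices of `GL_{k+l}(F)`: products, spans, kernels and TYPE GROUPS
(negative-side lemma for the crux `SubgroupIdentityDesigns`, stmt-MatrixMultiplication-14079; cell B2b-5, gen 9)

Formalises LEMMA 2.2 ("types") of the block-slice analysis
(`run/shared/lean/b2b/levelgraded-cu/b2b-lgcu-borel-g8/BLOCK-SLICES.md` §2).
We work in `G = GL (Fin k ⊕ Fin l) F` and write `g = (A B; C D)` for the blocks of `g` w.r.t.
`F^k ⊕ F^l` (`Ablk, Bblk, Cblk, Dblk`).  The BLOCK SLICE is `S = {g : D(g) = 1}`.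

* `slice_mul_iff` — for `g, h ∈ S`: `g h ∈ S ↔ C(g) B(h) = 0`;
* `USpan H = Σ_{h ∈ H} im B(h)`, `KInf H = ⋂_{h ∈ H} ker C(h)` (submodules of `F^k`);
* `USpan_le_KInf` — CROSS CONDITION: `H, H' ⊆ S` and `H·H' ⊆ S` give `U_{H'} ≤ K_H`
  (in particular `U_H ≤ K_H` for a subgroup `H ⊆ S`);
* `InType U K g` — `D(g) = 1`, `im B(g) ⊆ U`, `C(g)` kills `U` and `K`, `A(g)` preserves `U` and `K`;
  these elements form a submonoid `typeMonoid U K`, hence (finite field) a subgroup `typeGroup U K`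
  (`subgroupOfFinite`: in a finite group a submonoid is a subgroup);
* `le_typeGroup` — **LEMMA 2.2**: a subgroup `H ⊆ S` satisfies `H ≤ typeGroup (USpan H) (KInf H)`;
* `Ablk_mulVec_injective` — if `g⁻¹ ∈ S` then `A(g)` is injective (hence invertible): the
  `A`-block of a subgroup of the slice lives in `GL_k`.

Companion files: `BlockSliceConfinement.lean` (Lemma 2.3), `BlockSlicePacking.lean` (Theorem 2.4,
group side).  Sorry-free; standard axioms.  VALUE = theorems (referee-grade lemmas of the block-slice
analysis), NOT summit progress; the crux item stays open.
-/

set_option linter.dupNamespace false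

open scoped MatrixGroups Matrix
open Literature.Barriers.MatrixMultiplication

namespace Summit.MatrixMultiplication.MatrixMultiplication.Theorems.SubgroupIdentityDesigns.Negative

namespace BlockSliceTypes

/-! ## A finite-group generality -/

/-- In a finite group every submonoid is a subgroup (`x⁻¹ = x ^ (orderOf x - 1)`). -/
def subgroupOfFinite {G : Type*} [Group G] [Finite G] (S : Submonoid G) : Subgroup G where
  toSubmonoid := S
  inv_mem' := by
    intro x hx
    have h : x * x ^ (orderOf x - 1) = 1 := by
      rw [← pow_succ', Nat.sub_add_cancel (orderOf_pos x), pow_orderOf_eq_one]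
    rw [inv_eq_of_mul_eq_one_right h]
    exact S.pow_mem hx _

/-- Membership in `subgroupOfFinite S` is membership in `S`. -/
@[simp] theorem mem_subgroupOfFinite {G : Type*} [Group G] [Finite G] {S : Submonoid G} {x : G} :
    x ∈ subgroupOfFinite S ↔ x ∈ S := Iff.rfl

variable {F : Type*} [Field F] {k l : ℕ}

/-! ## Blocks -/

/-- Top-left `k × k` block `A(g)`. -/
def Ablk (g : GL (Fin k ⊕ Fin l) F) : Matrix (Fin k) (Fin k) F :=
  (g : Matrix (Fin k ⊕ Fin l) (Fin k ⊕ Fin l) F).toBlocks₁₁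

/-- Top-right `k × l` block `B(g)`. -/
def Bblk (g : GL (Fin k ⊕ Fin l) F) : Matrix (Fin k) (Fin l) F :=
  (g : Matrix (Fin k ⊕ Fin l) (Fin k ⊕ Fin l) F).toBlocks₁₂

/-- Bottom-left `l × k` block `C(g)`. -/
def Cblk (g : GL (Fin k ⊕ Fin l) F) : Matrix (Fin l) (Fin k) F :=
  (g : Matrix (Fin k ⊕ Fin l) (Fin k ⊕ Fin l) F).toBlocks₂₁

/-- Bottom-right `l × l` block `D(g)`. -/
def Dblk (g : GL (Fin k ⊕ Fin l) F) : Matrix (Fin l) (Fin l) F :=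
  (g : Matrix (Fin k ⊕ Fin l) (Fin k ⊕ Fin l) F).toBlocks₂₂

/-- `g` is the block matrix of its four blocks. -/
theorem fromBlocks_blk (g : GL (Fin k ⊕ Fin l) F) :
    Matrix.fromBlocks (Ablk g) (Bblk g) (Cblk g) (Dblk g) = (g : Matrix _ _ F) :=
  Matrix.fromBlocks_toBlocks _

/-- Block formula for the product of two square block matrices. -/
theorem toBlocks_mul (M N : Matrix (Fin k ⊕ Fin l) (Fin k ⊕ Fin l) F) :
    (M * N).toBlocks₁₁ = M.toBlocks₁₁ * N.toBlocks₁₁ + M.toBlocks₁₂ * N.toBlocks₂₁ ∧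
    (M * N).toBlocks₁₂ = M.toBlocks₁₁ * N.toBlocks₁₂ + M.toBlocks₁₂ * N.toBlocks₂₂ ∧
    (M * N).toBlocks₂₁ = M.toBlocks₂₁ * N.toBlocks₁₁ + M.toBlocks₂₂ * N.toBlocks₂₁ ∧
    (M * N).toBlocks₂₂ = M.toBlocks₂₁ * N.toBlocks₁₂ + M.toBlocks₂₂ * N.toBlocks₂₂ := by
  refine ⟨?_, ?_, ?_, ?_⟩ <;> ext i j <;>
    simp [Matrix.toBlocks₁₁, Matrix.toBlocks₁₂, Matrix.toBlocks₂₁, Matrix.toBlocks₂₂,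
      Matrix.mul_apply, Fintype.sum_sum_type]

/-- `A(g h) = A(g) A(h) + B(g) C(h)`. -/
theorem Ablk_mul (g h : GL (Fin k ⊕ Fin l) F) : Ablk (g * h) = Ablk g * Ablk h + Bblk g * Cblk h := by
  unfold Ablk Bblk Cblk; rw [Units.val_mul]; exact (toBlocks_mul _ _).1

/-- `B(g h) = A(g) B(h) + B(g) D(h)`. -/
theorem Bblk_mul (g h : GL (Fin k ⊕ Fin l) F) : Bblk (g * h) = Ablk g * Bblk h + Bblk g * Dblk h := by
  unfold Ablk Bblk Dblk; rw [Units.val_mul]; exact (toBlocks_mul _ _).2.1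

/-- `C(g h) = C(g) A(h) + D(g) C(h)`. -/
theorem Cblk_mul (g h : GL (Fin k ⊕ Fin l) F) : Cblk (g * h) = Cblk g * Ablk h + Dblk g * Cblk h := by
  unfold Ablk Cblk Dblk; rw [Units.val_mul]; exact (toBlocks_mul _ _).2.2.1

/-- `D(g h) = C(g) B(h) + D(g) D(h)`. -/
theorem Dblk_mul (g h : GL (Fin k ⊕ Fin l) F) : Dblk (g * h) = Cblk g * Bblk h + Dblk g * Dblk h := by
  unfold Bblk Cblk Dblk; rw [Units.val_mul]; exact (toBlocks_mul _ _).2.2.2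

/-- `A(1) = 1`. -/
@[simp] theorem Ablk_one : Ablk (1 : GL (Fin k ⊕ Fin l) F) = 1 := by
  unfold Ablk; rw [Units.val_one, ← Matrix.fromBlocks_one, Matrix.toBlocks_fromBlocks₁₁]

/-- `B(1) = 0`. -/
@[simp] theorem Bblk_one : Bblk (1 : GL (Fin k ⊕ Fin l) F) = 0 := by
  unfold Bblk; rw [Units.val_one, ← Matrix.fromBlocks_one, Matrix.toBlocks_fromBlocks₁₂]

/-- `C(1) = 0`. -/
@[simp] theorem Cblk_one : Cblk (1 : GL (Fin k ⊕ Fin l) F) = 0 := by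
  unfold Cblk; rw [Units.val_one, ← Matrix.fromBlocks_one, Matrix.toBlocks_fromBlocks₂₁]

/-- `D(1) = 1`. -/
@[simp] theorem Dblk_one : Dblk (1 : GL (Fin k ⊕ Fin l) F) = 1 := by
  unfold Dblk; rw [Units.val_one, ← Matrix.fromBlocks_one, Matrix.toBlocks_fromBlocks₂₂]

/-! ## The block slice `S = {g : D(g) = 1}` -/

/-- In the slice: `D(g h) = C(g) B(h) + 1`. -/
theorem Dblk_mul_of_slice {g h : GL (Fin k ⊕ Fin l) F} (hg : Dblk g = 1) (hh : Dblk h = 1) :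
    Dblk (g * h) = Cblk g * Bblk h + 1 := by
  rw [Dblk_mul, hg, hh, Matrix.one_mul]

/-- If `D(h) = 1`: `B(g h) = A(g) B(h) + B(g)`. -/
theorem Bblk_mul_of_slice {g h : GL (Fin k ⊕ Fin l) F} (hh : Dblk h = 1) :
    Bblk (g * h) = Ablk g * Bblk h + Bblk g := by
  rw [Bblk_mul, hh, Matrix.mul_one]

/-- If `D(g) = 1`: `C(g h) = C(g) A(h) + C(h)`. -/
theorem Cblk_mul_of_slice {g h : GL (Fin k ⊕ Fin l) F} (hg : Dblk g = 1) :
    Cblk (g * h) = Cblk g * Ablk h + Cblk h := by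
  rw [Cblk_mul, hg, Matrix.one_mul]

/-- For `g, h` in the slice: `g h ∈ S ↔ C(g) B(h) = 0` (Lemma 2.2, first clause). -/
theorem slice_mul_iff {g h : GL (Fin k ⊕ Fin l) F} (hg : Dblk g = 1) (hh : Dblk h = 1) :
    Dblk (g * h) = 1 ↔ Cblk g * Bblk h = 0 := by
  rw [Dblk_mul_of_slice hg hh]
  constructor
  · intro h1; simpa using h1
  · intro h0; rw [h0, zero_add]

/-- `C B = 0` iff `im B ⊆ ker C`. -/
theorem mul_eq_zero_iff_range_le_ker {a b c : ℕ} (C : Matrix (Fin a) (Fin b) F)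
    (B : Matrix (Fin b) (Fin c) F) :
    C * B = 0 ↔ LinearMap.range (Matrix.toLin' B) ≤ LinearMap.ker (Matrix.toLin' C) := by
  rw [LinearMap.range_le_ker_iff, ← Matrix.toLin'_mul]
  exact (LinearEquiv.map_eq_zero_iff Matrix.toLin').symm

/-- `C B = 0` from: the columns of `B` lie in `U` and `C` kills `U`. -/
theorem mul_eq_zero_of_mulVec {a b c : ℕ} {C : Matrix (Fin a) (Fin b) F} {B : Matrix (Fin b) (Fin c) F}
    (U : Submodule F (Fin b → F)) (hB : ∀ y, B *ᵥ y ∈ U) (hC : ∀ x ∈ U, C *ᵥ x = 0) :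
    C * B = 0 := by
  apply Matrix.toLin'.injective
  rw [map_zero]
  refine LinearMap.ext fun y => ?_
  rw [Matrix.toLin'_apply, LinearMap.zero_apply, ← Matrix.mulVec_mulVec]
  exact hC _ (hB y)

/-! ## `U_H` and `K_H` -/

/-- `U_H = Σ_{h ∈ H} im B(h) ≤ F^k`. -/
def USpan (H : Subgroup (GL (Fin k ⊕ Fin l) F)) : Submodule F (Fin k → F) :=
  ⨆ h : H, LinearMap.range (Matrix.toLin' (Bblk (h : GL (Fin k ⊕ Fin l) F)))

/-- `K_H = ⋂_{h ∈ H} ker C(h) ≤ F^k`. -/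
def KInf (H : Subgroup (GL (Fin k ⊕ Fin l) F)) : Submodule F (Fin k → F) :=
  ⨅ h : H, LinearMap.ker (Matrix.toLin' (Cblk (h : GL (Fin k ⊕ Fin l) F)))

/-- `im B(h) ≤ U_H` for `h ∈ H`. -/
theorem range_le_USpan {H : Subgroup (GL (Fin k ⊕ Fin l) F)} {h : GL (Fin k ⊕ Fin l) F}
    (hh : h ∈ H) : LinearMap.range (Matrix.toLin' (Bblk h)) ≤ USpan H :=
  le_iSup (fun h : H => LinearMap.range (Matrix.toLin' (Bblk (h : GL (Fin k ⊕ Fin l) F)))) ⟨h, hh⟩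

/-- `K_H ≤ ker C(h)` for `h ∈ H`. -/
theorem KInf_le_ker {H : Subgroup (GL (Fin k ⊕ Fin l) F)} {h : GL (Fin k ⊕ Fin l) F}
    (hh : h ∈ H) : KInf H ≤ LinearMap.ker (Matrix.toLin' (Cblk h)) :=
  iInf_le (fun h : H => LinearMap.ker (Matrix.toLin' (Cblk (h : GL (Fin k ⊕ Fin l) F)))) ⟨h, hh⟩

/-- `B(h) y ∈ U_H` for `h ∈ H`. -/
theorem mulVec_mem_USpan {H : Subgroup (GL (Fin k ⊕ Fin l) F)} {h : GL (Fin k ⊕ Fin l) F}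
    (hh : h ∈ H) (y : Fin l → F) : Bblk h *ᵥ y ∈ USpan H :=
  range_le_USpan hh ⟨y, Matrix.toLin'_apply _ _⟩

/-- `C(h) x = 0` for `h ∈ H`, `x ∈ K_H`. -/
theorem mulVec_eq_zero_of_mem_KInf {H : Subgroup (GL (Fin k ⊕ Fin l) F)}
    {h : GL (Fin k ⊕ Fin l) F} (hh : h ∈ H) {x : Fin k → F} (hx : x ∈ KInf H) :
    Cblk h *ᵥ x = 0 := by
  have := KInf_le_ker hh hx
  rwa [LinearMap.mem_ker, Matrix.toLin'_apply] at this

/-- CROSS CONDITIONS (Lemma 2.2): if `H ⊆ S`, `H' ⊆ S` and `H·H' ⊆ S` then `U_{H'} ≤ K_H`. -/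
theorem USpan_le_KInf {H H' : Subgroup (GL (Fin k ⊕ Fin l) F)} (hH : ∀ g ∈ H, Dblk g = 1)
    (hH' : ∀ h ∈ H', Dblk h = 1) (hprod : ∀ g ∈ H, ∀ h ∈ H', Dblk (g * h) = 1) :
    USpan H' ≤ KInf H := by
  refine iSup_le fun h => le_iInf fun g => ?_
  rw [← mul_eq_zero_iff_range_le_ker]
  exact (slice_mul_iff (hH g g.2) (hH' h h.2)).mp (hprod g g.2 h h.2)

/-- For a subgroup `H ⊆ S`: `U_H ≤ K_H`. -/
theorem USpan_le_KInf_self {H : Subgroup (GL (Fin k ⊕ Fin l) F)} (hH : ∀ g ∈ H, Dblk g = 1) :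
    USpan H ≤ KInf H :=
  USpan_le_KInf hH hH fun _ hg _ hh => hH _ (H.mul_mem hg hh)

/-- `A(g)` preserves `U_H` for `g ∈ H ⊆ S` (from `B(g h) = A(g) B(h) + B(g)`). -/
theorem Ablk_mulVec_mem_USpan {H : Subgroup (GL (Fin k ⊕ Fin l) F)} (hH : ∀ g ∈ H, Dblk g = 1)
    {g : GL (Fin k ⊕ Fin l) F} (hg : g ∈ H) {x : Fin k → F} (hx : x ∈ USpan H) :
    Ablk g *ᵥ x ∈ USpan H := by
  refine Submodule.iSup_induction _ hx (motive := fun x => Ablk g *ᵥ x ∈ USpan H) ?_ ?_ ?_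
  · rintro h x ⟨y, rfl⟩
    rw [Matrix.toLin'_apply, Matrix.mulVec_mulVec]
    have e : Ablk g * Bblk (h : GL (Fin k ⊕ Fin l) F) =
        Bblk (g * (h : GL (Fin k ⊕ Fin l) F)) - Bblk g := by
      rw [Bblk_mul_of_slice (hH _ h.2), add_sub_cancel_right]
    rw [e, Matrix.sub_mulVec]
    exact sub_mem (mulVec_mem_USpan (H.mul_mem hg h.2) y) (mulVec_mem_USpan hg y)
  · rw [Matrix.mulVec_zero]; exact zero_mem _
  · intro x y hx hy; rw [Matrix.mulVec_add]; exact add_mem hx hy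

/-- `A(g)` preserves `K_H` for `g ∈ H ⊆ S` (from `C(h g) = C(h) A(g) + C(g)`). -/
theorem Ablk_mulVec_mem_KInf {H : Subgroup (GL (Fin k ⊕ Fin l) F)} (hH : ∀ g ∈ H, Dblk g = 1)
    {g : GL (Fin k ⊕ Fin l) F} (hg : g ∈ H) {x : Fin k → F} (hx : x ∈ KInf H) :
    Ablk g *ᵥ x ∈ KInf H := by
  refine (Submodule.mem_iInf _).mpr fun h => ?_
  have e : Cblk (h : GL (Fin k ⊕ Fin l) F) * Ablk g =
      Cblk ((h : GL (Fin k ⊕ Fin l) F) * g) - Cblk g := by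
    rw [Cblk_mul_of_slice (hH _ h.2), add_sub_cancel_right]
  rw [LinearMap.mem_ker, Matrix.toLin'_apply, Matrix.mulVec_mulVec, e, Matrix.sub_mulVec,
    mulVec_eq_zero_of_mem_KInf (H.mul_mem h.2 hg) hx, mulVec_eq_zero_of_mem_KInf hg hx, sub_zero]

/-! ## Type groups `G(U,K)` and stabilisers `St(U,K)` -/

/-- `g` has TYPE `(U,K)`: `D(g) = 1`, `im B(g) ⊆ U`, `C(g)` kills `U` and `K`, `A(g)` preserves
`U` and `K`. -/
structure InType (U K : Submodule F (Fin k → F)) (g : GL (Fin k ⊕ Fin l) F) : Prop where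
  D_eq : Dblk g = 1
  B_mem : ∀ y, Bblk g *ᵥ y ∈ U
  C_U : ∀ x ∈ U, Cblk g *ᵥ x = 0
  C_K : ∀ x ∈ K, Cblk g *ᵥ x = 0
  A_U : ∀ x ∈ U, Ablk g *ᵥ x ∈ U
  A_K : ∀ x ∈ K, Ablk g *ᵥ x ∈ K

/-- `1` has every type. -/
theorem InType.one (U K : Submodule F (Fin k → F)) : InType U K (1 : GL (Fin k ⊕ Fin l) F) where
  D_eq := Dblk_one
  B_mem y := by rw [Bblk_one, Matrix.zero_mulVec]; exact zero_mem U
  C_U x _ := by rw [Cblk_one, Matrix.zero_mulVec]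
  C_K x _ := by rw [Cblk_one, Matrix.zero_mulVec]
  A_U x hx := by rw [Ablk_one, Matrix.one_mulVec]; exact hx
  A_K x hx := by rw [Ablk_one, Matrix.one_mulVec]; exact hx

/-- Types are closed under multiplication. -/
theorem InType.mul {U K : Submodule F (Fin k → F)} {g h : GL (Fin k ⊕ Fin l) F}
    (hg : InType U K g) (hh : InType U K h) : InType U K (g * h) where
  D_eq := (slice_mul_iff hg.D_eq hh.D_eq).mpr (mul_eq_zero_of_mulVec U hh.B_mem hg.C_U)
  B_mem y := by
    rw [Bblk_mul_of_slice hh.D_eq, Matrix.add_mulVec, ← Matrix.mulVec_mulVec]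
    exact add_mem (hg.A_U _ (hh.B_mem y)) (hg.B_mem y)
  C_U x hx := by
    rw [Cblk_mul_of_slice hg.D_eq, Matrix.add_mulVec, ← Matrix.mulVec_mulVec,
      hg.C_U _ (hh.A_U x hx), hh.C_U x hx, add_zero]
  C_K x hx := by
    rw [Cblk_mul_of_slice hg.D_eq, Matrix.add_mulVec, ← Matrix.mulVec_mulVec,
      hg.C_K _ (hh.A_K x hx), hh.C_K x hx, add_zero]
  A_U x hx := by
    rw [Ablk_mul, Matrix.add_mulVec, ← Matrix.mulVec_mulVec, ← Matrix.mulVec_mulVec,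
      hh.C_U x hx, Matrix.mulVec_zero, add_zero]
    exact hg.A_U _ (hh.A_U x hx)
  A_K x hx := by
    rw [Ablk_mul, Matrix.add_mulVec, ← Matrix.mulVec_mulVec, ← Matrix.mulVec_mulVec,
      hh.C_K x hx, Matrix.mulVec_zero, add_zero]
    exact hg.A_K _ (hh.A_K x hx)

/-- The elements of type `(U,K)` form a submonoid of `GL_{k+l}(F)`. -/
def typeMonoid (U K : Submodule F (Fin k → F)) : Submonoid (GL (Fin k ⊕ Fin l) F) where
  carrier := {g | InType U K g}
  one_mem' := InType.one U K
  mul_mem' := fun hg hh => InType.mul hg hh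

/-- The TYPE GROUP `G(U,K) ≤ GL_{k+l}(F)` (finite field). -/
def typeGroup [Finite F] (U K : Submodule F (Fin k → F)) : Subgroup (GL (Fin k ⊕ Fin l) F) :=
  subgroupOfFinite (typeMonoid U K)

/-- Membership in the type group. -/
@[simp] theorem mem_typeGroup [Finite F] {U K : Submodule F (Fin k → F)} {g : GL (Fin k ⊕ Fin l) F} :
    g ∈ typeGroup (l := l) U K ↔ InType U K g := Iff.rfl

/-- `A ∈ GL_k(F)` stabilises `U` and `K`. -/
structure InStab (U K : Submodule F (Fin k → F)) (A : GL (Fin k) F) : Prop where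
  A_U : ∀ x ∈ U, (A : Matrix (Fin k) (Fin k) F) *ᵥ x ∈ U
  A_K : ∀ x ∈ K, (A : Matrix (Fin k) (Fin k) F) *ᵥ x ∈ K

/-- The stabiliser of `U` and `K` as a submonoid of `GL_k(F)`. -/
def stabMonoid (U K : Submodule F (Fin k → F)) : Submonoid (GL (Fin k) F) where
  carrier := {A | InStab U K A}
  one_mem' := show InStab U K 1 from
    { A_U := fun x hx => by rw [Units.val_one, Matrix.one_mulVec]; exact hx
      A_K := fun x hx => by rw [Units.val_one, Matrix.one_mulVec]; exact hx }
  mul_mem' := by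
    intro A A' (hA : InStab U K A) (hA' : InStab U K A')
    show InStab U K (A * A')
    exact
      { A_U := fun x hx => by
          rw [Units.val_mul, ← Matrix.mulVec_mulVec]; exact hA.A_U _ (hA'.A_U x hx)
        A_K := fun x hx => by
          rw [Units.val_mul, ← Matrix.mulVec_mulVec]; exact hA.A_K _ (hA'.A_K x hx) }

/-- The STABILISER GROUP `St(U,K) ≤ GL_k(F)` (finite field). -/
def stabGroup [Finite F] (U K : Submodule F (Fin k → F)) : Subgroup (GL (Fin k) F) :=
  subgroupOfFinite (stabMonoid U K)

/-- Membership in the stabiliser group. -/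
@[simp] theorem mem_stabGroup [Finite F] {U K : Submodule F (Fin k → F)} {A : GL (Fin k) F} :
    A ∈ stabGroup U K ↔ InStab U K A := Iff.rfl

/-! ## LEMMA 2.2 (types) -/

/-- **LEMMA 2.2 (types).**  A subgroup `H` of `GL_{k+l}(F)` contained in the block slice
`S = {D = 1}` is contained in the type group `G(U_H, K_H)`. -/
theorem le_typeGroup [Finite F] {H : Subgroup (GL (Fin k ⊕ Fin l) F)} (hH : ∀ g ∈ H, Dblk g = 1) :
    H ≤ typeGroup (USpan H) (KInf H) := by
  intro g hg
  show InType (USpan H) (KInf H) g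
  exact
    { D_eq := hH g hg
      B_mem := fun y => mulVec_mem_USpan hg y
      C_U := fun x hx => mulVec_eq_zero_of_mem_KInf hg (USpan_le_KInf_self hH hx)
      C_K := fun x hx => mulVec_eq_zero_of_mem_KInf hg hx
      A_U := fun x hx => Ablk_mulVec_mem_USpan hH hg hx
      A_K := fun x hx => Ablk_mulVec_mem_KInf hH hg hx }

/-! ## The `A`-block of a slice subgroup is invertible -/

/-- If `g⁻¹` lies in the slice then `A(g)` is injective: from `A x = 0`,
`(x,0) = g⁻¹ (g (x,0)) = g⁻¹ (0, C x) = (B' C x, D' C x)` with `D' = 1`, so `C x = 0`, `x = 0`. -/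
theorem Ablk_mulVec_injective {g : GL (Fin k ⊕ Fin l) F} (hinv : Dblk g⁻¹ = 1) :
    Function.Injective (Ablk g).mulVec := by
  have key : ∀ x : Fin k → F, Ablk g *ᵥ x = 0 → x = 0 := by
    intro x hx
    have h1 : (g : Matrix (Fin k ⊕ Fin l) (Fin k ⊕ Fin l) F) *ᵥ Sum.elim x (0 : Fin l → F) =
        Sum.elim (0 : Fin k → F) (Cblk g *ᵥ x) := by
      rw [← fromBlocks_blk g, Matrix.fromBlocks_mulVec]
      simp [hx]
    have h2 : Sum.elim x (0 : Fin l → F) =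
        ((g⁻¹ : GL (Fin k ⊕ Fin l) F) : Matrix (Fin k ⊕ Fin l) (Fin k ⊕ Fin l) F) *ᵥ
          Sum.elim (0 : Fin k → F) (Cblk g *ᵥ x) := by
      rw [← h1, Matrix.mulVec_mulVec, Units.inv_mul, Matrix.one_mulVec]
    have h3 : ((g⁻¹ : GL (Fin k ⊕ Fin l) F) : Matrix (Fin k ⊕ Fin l) (Fin k ⊕ Fin l) F) *ᵥ
          Sum.elim (0 : Fin k → F) (Cblk g *ᵥ x) =
        Sum.elim (Bblk g⁻¹ *ᵥ (Cblk g *ᵥ x)) (Cblk g *ᵥ x) := by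
      rw [← fromBlocks_blk g⁻¹, Matrix.fromBlocks_mulVec]
      simp [hinv]
    rw [h3] at h2
    have hC : Cblk g *ᵥ x = 0 := by
      funext i
      have := congr_fun h2 (Sum.inr i)
      simpa using this.symm
    funext i
    have := congr_fun h2 (Sum.inl i)
    simpa [hC] using this
  intro x y hxy
  exact sub_eq_zero.mp (key (x - y) (by rw [Matrix.mulVec_sub, hxy, sub_self]))

/-- Hence `A(g)` is invertible when `g⁻¹ ∈ S`. -/
theorem isUnit_Ablk {g : GL (Fin k ⊕ Fin l) F} (hinv : Dblk g⁻¹ = 1) : IsUnit (Ablk g) :=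
  Matrix.mulVec_injective_iff_isUnit.mp (Ablk_mulVec_injective hinv)

/-- In a type group, `A(g)` is invertible. -/
theorem isUnit_Ablk_of_mem_typeGroup [Finite F] {U K : Submodule F (Fin k → F)}
    {g : GL (Fin k ⊕ Fin l) F} (hg : g ∈ typeGroup (l := l) U K) : IsUnit (Ablk g) :=
  isUnit_Ablk (mem_typeGroup.mp ((typeGroup U K).inv_mem hg)).D_eq

/-- In a type group, `A(g)` as an element of `GL_k(F)` lies in the stabiliser group `St(U,K)`. -/
theorem unit_Ablk_mem_stabGroup [Finite F] {U K : Submodule F (Fin k → F)}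
    {g : GL (Fin k ⊕ Fin l) F} (hg : g ∈ typeGroup (l := l) U K) :
    (isUnit_Ablk_of_mem_typeGroup hg).unit ∈ stabGroup U K :=
  show InStab U K _ from
  { A_U := fun x hx => by rw [IsUnit.unit_spec]; exact (mem_typeGroup.mp hg).A_U x hx
    A_K := fun x hx => by rw [IsUnit.unit_spec]; exact (mem_typeGroup.mp hg).A_K x hx }

end BlockSliceTypes

end Summit.MatrixMultiplication.MatrixMultiplication.Theorems.SubgroupIdentityDesigns.Negative
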